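import Summits.CriticalPhenomena.PercolationContinuityZ3.Theorems.PercNearOneGluingNoHeavyLowerTailStarSetMixedLevelTwo
import Summits.CriticalPhenomena.PercolationContinuityZ3.Theorems.PercNearOneGluingNoHeavyLowerTailStarSetSupplyU0
import HarnessLib

/-!
# `NoHeavyLowerTail` (stmt-CriticalPhenomena-4575) — OES at level `j ≤ 2` for ANY two-port star multigraph, conditional ONLY on U1'_r

Support file (prover `prim-gen-swap` gen 9; `--supports stmt-CriticalPhenomena-4575`).  No definitions, no named facts, no sorries.

Combines `StarSet.setCS_twoPortStarMultigraph_mixed_levelTwo` (the MWF certificate, hypotheses hU0/hU1) with `StarSet.mwf_supply_U0` (U0' proved,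
MWF-CERT §5): for a two-port star multigraph whose classes are a forest in leaf-peeling order (`hforest`) plus chords, each chord dominated at each
port by an adjacent forest class off the chord (`hdomF` — e.g. a maximum-weight spanning forest of the class graph), the observer-extension
inequality `μ(c ↮ S, 1 ≤ |π(S)| ≤ j) ≤ μ(c ↮ S, |π(c)| ≤ j)` holds as soon as the single remaining supply inequality `hU1` (U1'_r, MWF-CERT §7) does.

* `StarSet.setCS_twoPortStarMultigraph_mixed_levelTwo_of_U1`.
-/

noncomputable section

namespace Summit.CriticalPhenomena.PercolationContinuityZ3.Theorems

open MeasureTheory Set Literature.Probability.LatticeModels Literature.Probability.Percolation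
open scoped Classical BigOperators

variable {n m Mf Mc : ℕ}

namespace StarSet

/-- **OES_{j≤2} for any two-port star multigraph given only U1'_r.**  See the file header.
[cite: VandenbergHaggstromKahn2005, Thm. 1.5 (p. 7) — the only non-elementary input, via `observerSet_le_of_lonelier`] -/
theorem setCS_twoPortStarMultigraph_mixed_levelTwo_of_U1 (w : Sym2 (Fin n) → unitInterval) (A : Finset (Fin n)) (s p p' : Fin m → Fin n)
    (cls : Fin m → Fin (Mf + Mc)) (P P' : Fin (Mf + Mc) → Fin n) (hP : ∀ i, p i = P (cls i)) (hP' : ∀ i, p' i = P' (cls i))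
    (c : Fin n) (j : ℕ) (hj : j ≤ 2) (hs : Function.Injective s) (hsA : ∀ i, s i ∉ A)
    (hPA : ∀ I, P I ∈ A) (hP'A : ∀ I, P' I ∈ A) (hPP' : ∀ I, P I ≠ P' I)
    (hnopar : ∀ I K : Fin (Mf + Mc), I ≠ K → ¬ ((P K = P I ∨ P K = P' I) ∧ (P' K = P I ∨ P' K = P' I)))
    (hforest : ∀ K I : Fin Mf, K < I → P' (Fin.castAdd Mc K) ≠ P (Fin.castAdd Mc I) ∧ P' (Fin.castAdd Mc K) ≠ P' (Fin.castAdd Mc I))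
    (hcA : c ∈ A) (hcP : ∀ I, c ≠ P I ∧ c ≠ P' I)
    (hobs : ∀ i u, u ≠ s i → u ≠ p i → u ≠ p' i → w s(s i, u) = 0)
    (hdom : ∀ I,
      (prodBernoulli w).real {ω : BondConfig (Fin n) | (A.filter fun z => ω ∈ openConn (P I) z).card ≤ j} ≤
          (prodBernoulli w).real {ω : BondConfig (Fin n) | (A.filter fun z => ω ∈ openConn c z).card ≤ j} ∧
        (prodBernoulli w).real {ω : BondConfig (Fin n) | (A.filter fun z => ω ∈ openConn (P' I) z).card ≤ j} ≤
          (prodBernoulli w).real {ω : BondConfig (Fin n) | (A.filter fun z => ω ∈ openConn c z).card ≤ j})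
    (hdomF : ∀ K : Fin Mc, ∀ d : Fin n, (d = P (Fin.natAdd Mf K) ∨ d = P' (Fin.natAdd Mf K)) →
      ∃ I : Fin Mf, (P (Fin.castAdd Mc I) = d ∨ P' (Fin.castAdd Mc I) = d) ∧
        (P (Fin.castAdd Mc I) ∉ ({P (Fin.natAdd Mf K), P' (Fin.natAdd Mf K)} : Finset (Fin n)) ∨
          P' (Fin.castAdd Mc I) ∉ ({P (Fin.natAdd Mf K), P' (Fin.natAdd Mf K)} : Finset (Fin n))) ∧
        ∏ i ∈ Finset.univ.filter (fun i => cls i = Fin.castAdd Mc I), (1 - (w s(s i, p i) : ℝ) * w s(s i, p' i)) ≤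
          ∏ i ∈ Finset.univ.filter (fun i => cls i = Fin.natAdd Mf K), (1 - (w s(s i, p i) : ℝ) * w s(s i, p' i)))
    (hU1 : ∀ r, (∏ i, (if (w s(s i, p i) : ℝ) * w s(s i, p' i) < 1 then
          ((1 - (w s(s i, p i) : ℝ)) * (1 - w s(s i, p' i))) / (1 - (w s(s i, p i) : ℝ) * w s(s i, p' i)) else 0)) *
        (∑ I ∈ (Finset.univ : Finset (Fin Mf)).filter (fun I => P (Fin.castAdd Mc I) ≠ r), ((1 - ∏ i ∈ Finset.univ.filter (fun i => cls i = Fin.castAdd Mc I), (1 - (w s(s i, p i) : ℝ) * w s(s i, p' i))) *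
          ∏ K ∈ Finset.univ.filter (· < I), ∏ i ∈ Finset.univ.filter (fun i => cls i = Fin.castAdd Mc K), (1 - (w s(s i, p i) : ℝ) * w s(s i, p' i))) +
        ∑ K ∈ (Finset.univ : Finset (Fin Mc)).filter (fun K => P (Fin.natAdd Mf K) ≠ r ∧ P' (Fin.natAdd Mf K) ≠ r), ((1 - ∏ i ∈ Finset.univ.filter (fun i => cls i = Fin.natAdd Mf K), (1 - (w s(s i, p i) : ℝ) * w s(s i, p' i))) *
          ∏ κ' ∈ Finset.univ.filter (fun κ' => ¬ (P κ' = P (Fin.natAdd Mf K) ∨ P κ' = P' (Fin.natAdd Mf K) ∨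
              P' κ' = P (Fin.natAdd Mf K) ∨ P' κ' = P' (Fin.natAdd Mf K))),
            ∏ i ∈ Finset.univ.filter (fun i => cls i = κ'), (1 - (w s(s i, p i) : ℝ) * w s(s i, p' i)))) ≤
      (∏ i, (if (w s(s i, p i) : ℝ) * w s(s i, p' i) < 1 then
          ((1 - (w s(s i, p i) : ℝ)) * (1 - w s(s i, p' i))) / (1 - (w s(s i, p i) : ℝ) * w s(s i, p' i)) else 0)) +
      ∑ e ∈ (Finset.univ : Finset (Fin m → Fin 3)).filter (fun e =>
          r ∉ (Finset.univ.filter fun i => e i = 1).image p ∪ (Finset.univ.filter fun i => e i = 2).image p'),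
        (if 3 ≤ ((Finset.univ.filter fun i => e i = 1).image p ∪ (Finset.univ.filter fun i => e i = 2).image p').card then
          ∏ i, (if (w s(s i, p i) : ℝ) * w s(s i, p' i) < 1 then
            ((if e i = 1 then (w s(s i, p i) : ℝ) else 1 - w s(s i, p i)) *
              (if e i = 2 then (w s(s i, p' i) : ℝ) else 1 - w s(s i, p' i))) / (1 - (w s(s i, p i) : ℝ) * w s(s i, p' i))
          else if e i = 1 then 1 else 0) else 0)) :
    (prodBernoulli w).real {ω : BondConfig (Fin n) | (∀ x ∈ Finset.univ.image s, ω ∉ openConn c x) ∧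
        1 ≤ (A.filter fun z => ∃ x ∈ Finset.univ.image s, ω ∈ openConn x z).card ∧
        (A.filter fun z => ∃ x ∈ Finset.univ.image s, ω ∈ openConn x z).card ≤ j} ≤
      (prodBernoulli w).real {ω : BondConfig (Fin n) | (∀ x ∈ Finset.univ.image s, ω ∉ openConn c x) ∧
        (A.filter fun z => ω ∈ openConn c z).card ≤ j} :=
  setCS_twoPortStarMultigraph_mixed_levelTwo w A s p p' cls P P' hP hP' c j hj hs hsA hPA hP'A hPP' hnopar hforest hcA hcP hobs hdom
    (mwf_supply_U0 w s p p' cls P P' hP hP' hPP' hnopar hdomF) hU1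

end StarSet

end Summit.CriticalPhenomena.PercolationContinuityZ3.Theorems

end
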